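import Summits.AtomisticToContinuum.HydrodynamicLimit.Theorems.OneFlightGossipEngineUniformLocalGibbsConcentrationDensity
import Summits.AtomisticToContinuum.HydrodynamicLimit.Theorems.OneFlightGossipEngineUniformLocalGibbsConcentrationVelocity

/-!
# Field-wise exponential bounds for local Gibbs states (bookkeeping)

Helper file for the support item `UniformLocalGibbsConcentration` (routes `OneFlightGossipEngine`, `TwoClocks`)
(stmt-AtomisticToContinuum-14445): the pieces of the assembly that mirrors
`localGibbs_lln_of_densityLLN` of `HardSphereEulerProofs`, with RATES.

* rate bookkeeping: `K e^{-n/K}` is monotone in `K` (`Kexp_le_Kexp`) and absorbs `2 e^{-rn}`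
  (`two_exp_le_Kexp`);
* `measure_lt_abs_add_le` — splitting of deviation events;
* `localGibbsMeasure_density_le` — the density-field bound under the local Gibbs MEASURE for an
  arbitrary continuous weight `g`, centred at `∫ g ρ₀`, `ρ₀ = rhoLim (profileOf a₀) σ` (position
  marginal = canonical gas, `posGibbsMeasure_eq`, and `density_concentration`);
* `expMoment_coord`, `expMoment_energy` — the uniform exponential moments of the momentum and
  kinetic-energy fluctuations (instances of `exists_expMoment_of_quadratic_bound`);
* `localGibbsMeasure_velFluct_Kexp` — the velocity-fluctuation bound in `K e^{-n/K}` form.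
-/

noncomputable section

namespace Summit.AtomisticToContinuum.HydrodynamicLimit.Theorems

namespace UniformLGC

open MeasureTheory ProbabilityTheory Filter Set Topology Finset
open scoped ENNReal InnerProductSpace
open Literature.MathematicalPhysics.KineticTheory Literature.MathematicalPhysics.StatisticalMechanics

/-! ### Rate bookkeeping -/

/-- `e^{-n/K} ≤ e^{-n/K'}` for `0 < K ≤ K'`, `n ≥ 0`. -/
theorem exp_negInv_le {K K' n : ℝ} (hK : 0 < K) (hKK' : K ≤ K') (hn : 0 ≤ n) :
    Real.exp (-(K⁻¹ * n)) ≤ Real.exp (-(K'⁻¹ * n)) := by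
  have hinv : K'⁻¹ ≤ K⁻¹ := inv_anti₀ hK hKK'
  exact Real.exp_le_exp.2 (by nlinarith)

/-- `K e^{-n/K}` is monotone in `K > 0` (for `n ≥ 0`). -/
theorem Kexp_le_Kexp {K K' n : ℝ} (hK : 0 < K) (hKK' : K ≤ K') (hn : 0 ≤ n) :
    K * Real.exp (-(K⁻¹ * n)) ≤ K' * Real.exp (-(K'⁻¹ * n)) :=
  mul_le_mul hKK' (exp_negInv_le hK hKK' hn) (Real.exp_pos _).le (hK.le.trans hKK')

/-- `2 e^{-rn} ≤ K e^{-n/K}` with `K = 2 + r⁻¹`. -/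
theorem two_exp_le_Kexp {r n : ℝ} (hr : 0 < r) (hn : 0 ≤ n) :
    2 * Real.exp (-(r * n)) ≤ (2 + r⁻¹) * Real.exp (-((2 + r⁻¹)⁻¹ * n)) := by
  have hr' : 0 < r⁻¹ := inv_pos.2 hr
  have hK : 0 < 2 + r⁻¹ := by positivity
  have hKr : (2 + r⁻¹)⁻¹ ≤ r := by
    rw [inv_le_comm₀ hK hr]; linarith
  have h1 : Real.exp (-(r * n)) ≤ Real.exp (-((2 + r⁻¹)⁻¹ * n)) := Real.exp_le_exp.2 (by nlinarith)
  have h2 : 0 < Real.exp (-((2 + r⁻¹)⁻¹ * n)) := Real.exp_pos _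
  nlinarith

/-- In `ℝ≥0∞`: two `K e^{-n/K}` bounds add up to one with `K₁ + K₂`. -/
theorem ofReal_Kexp_add_le {K₁ K₂ n : ℝ} (hK₁ : 0 < K₁) (hK₂ : 0 < K₂) (hn : 0 ≤ n) :
    ENNReal.ofReal (K₁ * Real.exp (-(K₁⁻¹ * n))) + ENNReal.ofReal (K₂ * Real.exp (-(K₂⁻¹ * n))) ≤
      ENNReal.ofReal ((K₁ + K₂) * Real.exp (-((K₁ + K₂)⁻¹ * n))) := by
  rw [← ENNReal.ofReal_add (by positivity) (by positivity)]
  refine ENNReal.ofReal_le_ofReal ?_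
  have h1 := exp_negInv_le hK₁ (le_add_of_nonneg_right hK₂.le : K₁ ≤ K₁ + K₂) hn
  have h2 := exp_negInv_le hK₂ (le_add_of_nonneg_left hK₁.le : K₂ ≤ K₁ + K₂) hn
  have h3 : 0 < Real.exp (-((K₁ + K₂)⁻¹ * n)) := Real.exp_pos _
  nlinarith

/-- **Splitting of deviation events**: `ℙ(2η < |A + B|) ≤ ℙ(η ≤ |A|) + ℙ(η < |B|)`. -/
theorem measure_lt_abs_add_le {Ω : Type*} [MeasurableSpace Ω] (μ : Measure Ω) (A B : Ω → ℝ) (η : ℝ) :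
    μ {z | 2 * η < |A z + B z|} ≤ μ {z | η ≤ |A z|} + μ {z | η < |B z|} := by
  calc μ {z | 2 * η < |A z + B z|} ≤ μ ({z | η ≤ |A z|} ∪ {z | η < |B z|}) := by
        refine measure_mono fun z hz => ?_
        simp only [Set.mem_setOf_eq, Set.mem_union] at hz ⊢
        by_contra h
        push Not at h
        have := abs_add_le (A z) (B z)
        linarith [h.1, h.2]
    _ ≤ μ {z | η ≤ |A z|} + μ {z | η < |B z|} := measure_union_le _ _

/-! ### The density field under the local Gibbs measure -/

section Density

variable {a₀ θ₀ : T3 → ℝ} {u₀ : T3 → V3} {σ : ℝ}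

/-- **Density-type events with rates.** For continuous profiles, `0 < σ < 1/2` with the uniform
smallness `e · 2M · v₁ · σ³ ≤ 1/32` for `P = profileOf a₀`, a continuous weight `g` and `δ > 0`:
`localGibbsMeasure {δ < |(N+1)⁻¹ ∑ g(xᵢ) - ∫ g ρ₀|} ≤ K e^{-(N+1)/K}` for all `N`,
`ρ₀ = rhoLim P σ`. -/
theorem localGibbsMeasure_density_le (ha : Continuous a₀) (hθ : Continuous θ₀) (hu : Continuous u₀)
    (ha0 : ∀ x, 0 < a₀ x) (hθ0 : ∀ x, 0 < θ₀ x) (hσ : 0 < σ) (hσ2 : σ < 1 / 2)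
    (hsmall : Real.exp 1 * (2 * (profileOf a₀ ha ha0).M * v₁ * σ ^ 3) ≤ 1 / 32)
    {g : T3 → ℝ} (hg : Continuous g) {δ : ℝ} (hδ : 0 < δ) :
    ∃ K : ℝ, 0 < K ∧ ∀ N : ℕ, localGibbsMeasure σ a₀ u₀ θ₀ N
        {z | δ < |((N + 1 : ℕ) : ℝ)⁻¹ * ∑ i, g (z i).1 - ∫ y, g y * rhoLim (profileOf a₀ ha ha0) σ y|} ≤
      ENNReal.ofReal (K * Real.exp (-(K⁻¹ * ((N : ℝ) + 1)))) := by
  set P := profileOf a₀ ha ha0 with hP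
  have hPs : SmallDensity P σ :=
    smallDensity_of_eta_le (Mstar := 2 * P.M) hσ hσ2 (by linarith [P.M_pos]) (by
      calc Real.exp 1 * (2 * P.M * v₁ * σ ^ 3) = Real.exp 1 * (2 * P.M * v₁ * σ ^ 3) := rfl
        _ ≤ 1 / 32 := hsmall)
  obtain ⟨K, hK, hbound⟩ := density_concentration hσ hσ2 hsmall hg hδ
  refine ⟨K, hK, fun N => ?_⟩
  rw [← hPs.Ilim_eq_integral hg]
  have hS : MeasurableSet {x : Fin (N + 1) → T3 |
      δ < |((N + 1 : ℕ) : ℝ)⁻¹ * ∑ i, g (x i) - Ilim P σ g|} :=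
    measurableSet_lt measurable_const ((measurable_const.mul (Finset.measurable_sum _
      fun i _ => hg.measurable.comp (measurable_pi_apply i))).sub measurable_const).abs
  have h1 := localGibbsMeasure_preimage_pos (u₀ := u₀) ha hθ hu (fun x => (ha0 x).le) hθ0 σ N hS
  rw [posGibbsMeasure_eq ha ha0] at h1
  exact (le_of_eq h1).trans (hbound N)

end Density

/-! ### Exponential moments of the momentum and energy fluctuations -/

section Moments

variable {θ₀ : T3 → ℝ} {u₀ : T3 → V3}

/-- `|w| ≤ 1 + |w|²`. -/
theorem norm_le_one_add_sq (w : V3) : ‖w‖ ≤ 1 + ‖w‖ ^ 2 := by nlinarith [norm_nonneg w, sq_nonneg (‖w‖ - 1)]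

/-- **Momentum fluctuations** `Y(x, v) = vₗ - u₀(x)ₗ` have uniform exponential moments. -/
theorem expMoment_coord (hθ : Continuous θ₀) (hu : Continuous u₀) (l : Fin 3) :
    ∃ s₀ A : ℝ, 0 < s₀ ∧ 0 < A ∧ ∀ x,
      Integrable (fun v : V3 => Real.exp (s₀ * |v l - u₀ x l|)) (gaussMeasure (u₀ x) (θ₀ x)) ∧
        ∫ v, Real.exp (s₀ * |v l - u₀ x l|) ∂gaussMeasure (u₀ x) (θ₀ x) ≤ A := by
  obtain ⟨Θ, hΘ0, hΘ⟩ := exists_forall_abs_le_of_continuous hθ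
  have h := exists_expMoment_of_quadratic_bound (θ₀ := θ₀) (u₀ := u₀) (Y := fun x v => v l - u₀ x l)
    (by fun_prop) (K := Real.sqrt Θ + 1) (by positivity) (fun x w => ?_)
  · obtain ⟨s₀, A, hs₀, hA, hall⟩ := h
    exact ⟨s₀, A, hs₀, hA, hall⟩
  · simp only [PiLp.add_apply, PiLp.smul_apply, smul_eq_mul, add_sub_cancel_left]
    rw [abs_mul, abs_of_nonneg (Real.sqrt_nonneg _)]
    have h1 : Real.sqrt (θ₀ x) ≤ Real.sqrt Θ := Real.sqrt_le_sqrt ((le_abs_self _).trans (hΘ x))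
    have h2 : |w l| ≤ ‖w‖ := by
      have := PiLp.norm_apply_le w l
      rwa [Real.norm_eq_abs] at this
    have h3 := norm_le_one_add_sq w
    have h4 : 0 ≤ Real.sqrt (θ₀ x) := Real.sqrt_nonneg _
    calc Real.sqrt (θ₀ x) * |w l| ≤ Real.sqrt Θ * (1 + ‖w‖ ^ 2) :=
          mul_le_mul h1 (h2.trans h3) (abs_nonneg _) (Real.sqrt_nonneg _)
      _ ≤ (Real.sqrt Θ + 1) * (1 + ‖w‖ ^ 2) := by nlinarith [Real.sqrt_nonneg Θ, sq_nonneg ‖w‖]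

/-- **Kinetic-energy fluctuations** `Y(x, v) = |v|²/2 - |u₀(x)|²/2 - 3θ₀(x)/2` have uniform
exponential moments. -/
theorem expMoment_energy (hθ : Continuous θ₀) (hu : Continuous u₀) (hθ0 : ∀ x, 0 < θ₀ x) :
    ∃ s₀ A : ℝ, 0 < s₀ ∧ 0 < A ∧ ∀ x,
      Integrable (fun v : V3 => Real.exp (s₀ * |‖v‖ ^ 2 / 2 - ‖u₀ x‖ ^ 2 / 2 - Fintype.card (Fin 3) * θ₀ x / 2|))
          (gaussMeasure (u₀ x) (θ₀ x)) ∧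
        ∫ v, Real.exp (s₀ * |‖v‖ ^ 2 / 2 - ‖u₀ x‖ ^ 2 / 2 - Fintype.card (Fin 3) * θ₀ x / 2|)
          ∂gaussMeasure (u₀ x) (θ₀ x) ≤ A := by
  obtain ⟨Θ, hΘ0, hΘ⟩ := exists_forall_abs_le_of_continuous hθ
  obtain ⟨U, hU0, hU⟩ := exists_forall_abs_le_of_continuous (continuous_norm.comp hu)
  have h := exists_expMoment_of_quadratic_bound (θ₀ := θ₀) (u₀ := u₀)
    (Y := fun x v => ‖v‖ ^ 2 / 2 - ‖u₀ x‖ ^ 2 / 2 - Fintype.card (Fin 3) * θ₀ x / 2)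
    (by fun_prop) (K := Real.sqrt Θ * U + 3 * Θ / 2 + 1) (by positivity) (fun x w => ?_)
  · obtain ⟨s₀, A, hs₀, hA, hall⟩ := h
    exact ⟨s₀, A, hs₀, hA, hall⟩
  · rw [energy_shift_eq (u₀ x) (hθ0 x).le w]
    have hθx : θ₀ x ≤ Θ := (le_abs_self _).trans (hΘ x)
    have hux : ‖u₀ x‖ ≤ U := (le_abs_self _).trans (hU x)
    have h1 : Real.sqrt (θ₀ x) ≤ Real.sqrt Θ := Real.sqrt_le_sqrt hθx
    have h2 : |⟪u₀ x, w⟫_ℝ| ≤ U * ‖w‖ := (abs_real_inner_le_norm _ _).trans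
      (mul_le_mul_of_nonneg_right hux (norm_nonneg _))
    have h3 := norm_le_one_add_sq w
    have h4 : |‖w‖ ^ 2 - (Fintype.card (Fin 3) : ℝ)| ≤ ‖w‖ ^ 2 + 3 := by
      rw [Fintype.card_fin]; push_cast
      exact (abs_sub _ _).trans (by rw [abs_of_nonneg (sq_nonneg _)]; norm_num)
    have hsq : 0 ≤ Real.sqrt (θ₀ x) := Real.sqrt_nonneg _
    calc |Real.sqrt (θ₀ x) * ⟪u₀ x, w⟫_ℝ + θ₀ x / 2 * (‖w‖ ^ 2 - Fintype.card (Fin 3))|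
        ≤ Real.sqrt (θ₀ x) * |⟪u₀ x, w⟫_ℝ| + θ₀ x / 2 * |‖w‖ ^ 2 - (Fintype.card (Fin 3) : ℝ)| := by
          refine (abs_add_le _ _).trans ?_
          rw [abs_mul, abs_mul, abs_of_nonneg hsq, abs_of_nonneg (by linarith [hθ0 x] : (0 : ℝ) ≤ θ₀ x / 2)]
      _ ≤ Real.sqrt Θ * (U * (1 + ‖w‖ ^ 2)) + Θ / 2 * (‖w‖ ^ 2 + 3) := by
          have hUw : U * ‖w‖ ≤ U * (1 + ‖w‖ ^ 2) := mul_le_mul_of_nonneg_left h3 hU0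
          exact add_le_add (mul_le_mul h1 (h2.trans hUw) (abs_nonneg _) (Real.sqrt_nonneg Θ))
            (mul_le_mul (by linarith) h4 (abs_nonneg _) (by linarith))
      _ ≤ (Real.sqrt Θ * U + 3 * Θ / 2 + 1) * (1 + ‖w‖ ^ 2) := by
          nlinarith [Real.sqrt_nonneg Θ, sq_nonneg ‖w‖, mul_nonneg (Real.sqrt_nonneg Θ) hU0]

end Moments

/-! ### Velocity fluctuations in `K e^{-n/K}` form -/

section Velocity

variable {a₀ θ₀ : T3 → ℝ} {u₀ : T3 → V3}

/-- The velocity-fluctuation bound of `localGibbsMeasure_velFluct_exp_le` in the form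
`K e^{-(N+1)/K}`, uniformly in `N`, for `σ ≤ 1/2`. -/
theorem localGibbsMeasure_velFluct_Kexp (ha : Continuous a₀) (hθ : Continuous θ₀)
    (hu : Continuous u₀) (ha0 : ∀ x, 0 < a₀ x) (hθ0 : ∀ x, 0 < θ₀ x) {σ : ℝ} (hσ2 : σ ≤ 1 / 2)
    {Y : T3 → V3 → ℝ} (hYm : Measurable fun p : T3 × V3 => Y p.1 p.2)
    (hY0 : ∀ x, ∫ v, Y x v ∂gaussMeasure (u₀ x) (θ₀ x) = 0)
    (hYexp : ∃ s₀ A : ℝ, 0 < s₀ ∧ 0 < A ∧ ∀ x,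
      Integrable (fun v => Real.exp (s₀ * |Y x v|)) (gaussMeasure (u₀ x) (θ₀ x)) ∧
        ∫ v, Real.exp (s₀ * |Y x v|) ∂gaussMeasure (u₀ x) (θ₀ x) ≤ A)
    {χ : T3 → ℝ} (hχ : Continuous χ) {δ : ℝ} (hδ : 0 < δ) :
    ∃ K : ℝ, 0 < K ∧ ∀ N : ℕ, localGibbsMeasure σ a₀ u₀ θ₀ N
        {z | δ ≤ |((N + 1 : ℕ) : ℝ)⁻¹ * ∑ i, χ (z i).1 * Y (z i).1 (z i).2|} ≤
      ENNReal.ofReal (K * Real.exp (-(K⁻¹ * ((N : ℝ) + 1)))) := by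
  obtain ⟨s₀, A, hs₀, hA, hall⟩ := hYexp
  obtain ⟨C', hC'0, hχC'⟩ := exists_forall_abs_le_of_continuous hχ
  set C := C' + 1 with hC
  have hC0 : 0 < C := by rw [hC]; linarith
  have hχC : ∀ y, |χ y| ≤ C := fun y => (hχC' y).trans (by rw [hC]; linarith)
  set r := δ / 2 * min (s₀ / (2 * C)) (δ * s₀ ^ 2 / (64 * A * C ^ 2)) with hr
  have hr0 : 0 < r := by rw [hr]; exact mul_pos (by positivity) (lt_min (by positivity) (by positivity))
  refine ⟨2 + r⁻¹, by positivity, fun N => ?_⟩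
  haveI := isProbabilityMeasure_localGibbsMeasure ha hθ hu ha0 hθ0 hσ2 N
  have h := localGibbsMeasure_velFluct_exp_le ha hθ hu (fun x => (ha0 x).le) hθ0 σ N hYm hY0 hs₀ hA
    (fun x => (hall x).1) (fun x => (hall x).2) hχ hC0 hχC hδ
  refine h.trans (ENNReal.ofReal_le_ofReal ?_)
  have hn : (0 : ℝ) ≤ (N : ℝ) + 1 := by positivity
  have := two_exp_le_Kexp hr0 hn
  push_cast at this ⊢
  rw [← hr]
  exact this

end Velocity

end UniformLGC

end Summit.AtomisticToContinuum.HydrodynamicLimit.Theorems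

end
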